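import Summits.ResolutionOfSingularities.ResolutionOfSingularities.Theorems.FrobeniusLadderFInjectiveMacaulayficationRelClosedFixR
import Mathlib.Data.Set.Card
import HarnessLib

/-!
# The ABSORBING CLOSED-POINT STEP (T3ᵃ) for hole #3 — free centre, punctured-open-neighbourhood hypothesis anchored at the residual —
# its finite iteration, and FC″ at a non-closed bad point whose spread residual is finite and absorbing
# (crux `FInjectiveMacaulayfication` stmt-ResolutionOfSingularities-15315, chain w45a; res-L1-w45a-plan-1 R16.36 (1)–(2) — text (a) = plan-1's draft
# after res-L1-w45a-tri-2 KEEP #6 (the unanchored (T3ᵘ) collapses to FC″; the pinned (T3ʳ) is not ≤ S); seat res-L1-w45a-stub-1 g6)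

[OURS · L1 W4.5a] Support file (`--supports stmt-ResolutionOfSingularities-15315 --as helper`); NOT a statement of any manuscript;
AI-written (AI review is weaker than expert review). One `@[conjecture] def` (CANDIDATE statement of OURS) and sorry-free kernels; no named
facts.

THE STEP (T3ᵃ) `AbsorbingClosedPointStep`. Data: a nonzero centre `J₀`, a finite closed residual `Z ⊆ supp J₀`, an OPEN `V ⊇ supp J₀` such
that every blow-up along `J₀` is good over the punctured `V ∖ Z` («absorbing»: every bad stratum of `X₁` through a residual point lies in
`supp J₀` near it and is already cured off `Z` — rule M2), and a residual point `b ∈ Z`. Conclusion: data OF THE SAME SHAPE `(J₁, V₁, Z₁)` with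
`Z₁ ⊆ Z ∖ {b}` and every non-FULL point of `supp J₀` still in `supp J₁` — FREE centre, NO agreement clause (rule M1; the pinned
`RelClosedFixR.RelClosedFixR` is library only, tri-2 #223: not known ≤ S). CHECKS (plan-1 R16.36): ≤ S_proj + (BP): `J₁ := K` (blow-up
presentation of a projective resolution), `V₁ := ⊤`, `Z₁ := ∅`. Collapse test: `J₀ := I_b`, `Z := {b}` needs `b` ISOLATED in the bad locus
⇒ genuine sub-content (#4β♭ at an isolated bad closed point, free centre), not FC″. Content at a residual point = the isolated-in-the-residual
closed core of hole #3 (R16.34 ADJACENCY FACT).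

* `AbsorbingClosedPointStep` (T3ᵃ) — (a);
* `absorbingStep_iterate` — (b): induction on `ncard Z`; output `J ≠ ⊥`, `V′ ⊇ supp J` open, `GoodOver p X₁ J V′`, non-FULL points of
  `supp J₀` in `supp J` (the invariant IS the hypothesis shape);
* `locFixData_of_goodOver_nhd` — (e): a centre good over an open `U ∋ η` (η non-closed, `η ∈ supp J`, `J ≠ ⊥`) carries the (A′) datum at
  `η` for ANY generating tuple of `J_η` (points over the non-closed `η` are non-closed by properness, hence FULL; Stacks 0804 dictionary);
* `fcUnguardedOfFiniteResidualR_of_absorbingStep : AbsorbingClosedPointStep → RelClosedFixR.FCUnguardedOfFiniteResidualR` — (d): FC″ at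
  every non-closed bad `η` whose (A′) datum spreads with a finite ABSORBING residual (the def landed with p573608, hypothesis
  `supp J₀ ⊆ V ∧ GoodOver J₀ (V ∖ Z)`, `η ∉ Z`): iterate from the spread `J₀`; `η ∈ supp J` because `η` is non-FULL; the `η`-datum is
  RE-DERIVED from goodness near `η` by (e).
[folklore assembly]
-/

-- single-problem summit: the doubled namespace component is forced
set_option linter.dupNamespace false

noncomputable section

open AlgebraicGeometry CategoryTheory Literature.AlgebraicGeometry.Resolution TopologicalSpace IsLocalRing

namespace Summit.ResolutionOfSingularities.ResolutionOfSingularities.Theorems.FInjectiveMacaulayfication.AbsorbingStep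

open Summit.ResolutionOfSingularities.ResolutionOfSingularities.Theorems.FInjectiveMacaulayfication
open Summit.ResolutionOfSingularities.ResolutionOfSingularities.Theorems.FInjectiveMacaulayfication.SliceableCentre (CMCl FCl FullCl)
open Summit.ResolutionOfSingularities.ResolutionOfSingularities.Theorems.FInjectiveMacaulayfication.FCUnguardedAprime (GoodOver LocFixData)

/-! ## §1 (T3ᵃ) the absorbing closed-point step -/

/-- [OURS · CANDIDATE statement, not a fact] **(T3ᵃ) `AbsorbingClosedPointStep`** (plan-1 R16.36 (1), draft verbatim with «FULL» :=
`SliceableCentre.FullCl`): from an absorbing datum `(J₀ ≠ ⊥, Z finite closed ⊆ supp J₀ ⊆ V open, GoodOver J₀ (V ∖ Z))` and `b ∈ Z`, an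
absorbing datum `(J₁, V₁, Z₁)` with `Z₁ ⊆ Z ∖ {b}` keeping every non-FULL point of `supp J₀` in `supp J₁`. Free centre; ≤ S (J₁ := blow-up
presentation of a resolution, V₁ := ⊤, Z₁ := ∅); M1/M2-proof. Why it might fail: it is the isolated-in-the-residual closed-point core of hole
#3 (curing `b` may force the support to swallow the adjacency component of `b`). Junk: `J₀ = ⊤` excluded by `Z ⊆ supp J₀ ∋ b`.
[candidate statement, OURS; open] -/
@[conjecture] def AbsorbingClosedPointStep : Prop :=
  ∀ (p : ℕ), p.Prime → ∀ (k : Type) [Field k] [CharP k p]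
    (X₁ : Scheme.{0}) (f₁ : X₁ ⟶ Spec (.of k)),
      IsSeparated f₁ → LocallyOfFiniteType f₁ → QuasiCompact f₁ → IsIntegral X₁ → 4 ≤ topologicalKrullDim X₁ →
      (∀ x : X₁, CMCl (X₁.presheaf.stalk x)) →
      ∀ (J₀ : X₁.IdealSheafData) (Z : Set X₁) (V : X₁.Opens) (b : X₁), J₀ ≠ ⊥ → IsClosed Z → Z.Finite →
        Z ⊆ (J₀.support : Set X₁) → (J₀.support : Set X₁) ⊆ (V : Set X₁) → GoodOver p X₁ J₀ ((V : Set X₁) \ Z) → b ∈ Z →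
        ∃ (J₁ : X₁.IdealSheafData) (V₁ : X₁.Opens) (Z₁ : Set X₁), J₁ ≠ ⊥ ∧ IsClosed Z₁ ∧ Z₁ ⊆ Z \ {b} ∧
          Z₁ ⊆ (J₁.support : Set X₁) ∧ (J₁.support : Set X₁) ⊆ (V₁ : Set X₁) ∧ GoodOver p X₁ J₁ ((V₁ : Set X₁) \ Z₁) ∧
          (∀ x : X₁, x ∈ (J₀.support : Set X₁) → ¬ FullCl p (X₁.presheaf.stalk x) → x ∈ (J₁.support : Set X₁))

/-! ## §2 The finite iteration (the invariant is the hypothesis shape) -/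

/-- **ITERATION of (T3ᵃ)**: induction on the size of the finite residual `Z`; when `Z = ∅` the datum is good over the open `V ⊇ supp J`.
[folklore assembly, OURS] -/
theorem absorbingStep_iterate {X₁ : Scheme.{0}} {p : ℕ}
    (hstep : ∀ (J₀ : X₁.IdealSheafData) (Z : Set X₁) (V : X₁.Opens) (b : X₁), J₀ ≠ ⊥ → IsClosed Z → Z.Finite →
      Z ⊆ (J₀.support : Set X₁) → (J₀.support : Set X₁) ⊆ (V : Set X₁) → GoodOver p X₁ J₀ ((V : Set X₁) \ Z) → b ∈ Z →
      ∃ (J₁ : X₁.IdealSheafData) (V₁ : X₁.Opens) (Z₁ : Set X₁), J₁ ≠ ⊥ ∧ IsClosed Z₁ ∧ Z₁ ⊆ Z \ {b} ∧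
        Z₁ ⊆ (J₁.support : Set X₁) ∧ (J₁.support : Set X₁) ⊆ (V₁ : Set X₁) ∧ GoodOver p X₁ J₁ ((V₁ : Set X₁) \ Z₁) ∧
        (∀ x : X₁, x ∈ (J₀.support : Set X₁) → ¬ FullCl p (X₁.presheaf.stalk x) → x ∈ (J₁.support : Set X₁))) :
    ∀ (n : ℕ) (J₀ : X₁.IdealSheafData) (Z : Set X₁) (V : X₁.Opens), J₀ ≠ ⊥ → IsClosed Z → Z.Finite → Z.ncard ≤ n →
      Z ⊆ (J₀.support : Set X₁) → (J₀.support : Set X₁) ⊆ (V : Set X₁) → GoodOver p X₁ J₀ ((V : Set X₁) \ Z) →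
      ∃ (J : X₁.IdealSheafData) (V' : X₁.Opens), J ≠ ⊥ ∧ (J.support : Set X₁) ⊆ (V' : Set X₁) ∧ GoodOver p X₁ J (V' : Set X₁) ∧
        (∀ x : X₁, x ∈ (J₀.support : Set X₁) → ¬ FullCl p (X₁.presheaf.stalk x) → x ∈ (J.support : Set X₁)) := by
  intro n
  induction n with
  | zero =>
    intro J₀ Z V hJ₀ _ hfin hcard _ hJV hgood
    have hempty : Z = ∅ := (Set.ncard_eq_zero hfin).mp (Nat.le_zero.mp hcard)
    refine ⟨J₀, V, hJ₀, hJV, ?_, fun x hx _ => hx⟩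
    rw [hempty, Set.sdiff_empty] at hgood
    exact hgood
  | succ n ih =>
    intro J₀ Z V hJ₀ hZcl hfin hcard hZsub hJV hgood
    rcases Z.eq_empty_or_nonempty with hZ | ⟨b, hb⟩
    · refine ⟨J₀, V, hJ₀, hJV, ?_, fun x hx _ => hx⟩
      rw [hZ, Set.sdiff_empty] at hgood
      exact hgood
    · obtain ⟨J₁, V₁, Z₁, hJ₁, hZ₁cl, hZ₁sub, hZ₁J, hJ₁V, hgood₁, hkeep⟩ := hstep J₀ Z V b hJ₀ hZcl hfin hZsub hJV hgood hb
      have hfin' : (Z \ {b}).Finite := hfin.subset Set.sdiff_subset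
      have hfin₁ : Z₁.Finite := hfin'.subset hZ₁sub
      have hcard₁ : Z₁.ncard ≤ n := by
        have h1 := Set.ncard_le_ncard hZ₁sub hfin'
        have h2 : (Z \ {b}).ncard = Z.ncard - 1 := Set.ncard_sdiff_singleton_of_mem hb
        omega
      obtain ⟨J, V', hJ, hJV', hgoodJ, hkeep'⟩ := ih J₁ Z₁ V₁ hJ₁ hZ₁cl hfin₁ hcard₁ hZ₁J hJ₁V hgood₁
      exact ⟨J, V', hJ, hJV', hgoodJ, fun x hx hbad => hkeep' x (hkeep x hx hbad) hbad⟩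

/-! ## §3 Plumbing: goodness over an open neighbourhood of a non-closed point re-derives the (A′) datum there -/

/-- **A centre good over an open `U ∋ η` (η non-closed, `η ∈ supp J`, `J ≠ ⊥`) carries the (A′) LocFix datum at `η` for ANY generating
tuple `c′` of `J_η`**: every chart prime `𝔔` of `𝒪_η[(c′)/c′ⱼ]` over `𝔪_η` is the local ring of a blow-up point `x′` over `η`
(`IsBlowup.exists_point_of_blowupAlgebra_prime`, Stacks 0804); `x′` is NON-closed (its image `η` is not closed and blow-ups are proper, hence
closed maps), so it is FULL by `GoodOver`. [folklore; cite: StacksProject, Tag 0804] -/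
theorem locFixData_of_goodOver_nhd (p : ℕ) {X₁ : Scheme.{0}} [IsIntegral X₁] [IsLocallyNoetherian X₁] {η : X₁} {U : X₁.Opens}
    (hηU : η ∈ (U : Set X₁)) (hη : ¬ IsClosed ({η} : Set X₁)) {J : X₁.IdealSheafData} (hJ : J ≠ ⊥) (hηJ : η ∈ (J.support : Set X₁))
    (hgood : GoodOver p X₁ J (U : Set X₁)) {n' : ℕ} (c' : Fin n' → X₁.presheaf.stalk η) (hc : Ideal.span (Set.range c') = stalkIdeal J η) :
    LocFixData p X₁ η n' c' := by
  obtain ⟨X', π, hπ⟩ := exists_isBlowup X₁ J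
  haveI : IsProper π := hπ.isProper
  refine ⟨?_, ?_, fun j 𝔔 h𝔔 => ?_⟩
  · rw [hc]
    exact stalkIdeal_ne_bot_of_ne_bot hJ η
  · rw [hc]
    exact (mem_support_iff_stalkIdeal_le J η).mp hηJ
  · obtain ⟨x', hx', ⟨e⟩⟩ := hπ.exists_point_of_blowupAlgebra_prime η c' hc j 𝔔 h𝔔
    have hx'ncl : ¬ IsClosed ({x'} : Set X') := by
      intro hcl
      apply hη
      have himg : π.base '' {x'} = {η} := by rw [Set.image_singleton]; exact congrArg _ hx'
      rw [← himg]
      exact π.isClosedMap _ hcl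
    have hηU' : π.base x' ∈ (U : Set X₁) := by rw [show π.base x' = η from hx']; exact hηU
    exact WFixAtNonClosedDimTwo.fullCl_of_ringEquiv p e ((hgood X' π hπ).1 x' hηU' hx'ncl)

/-! ## §4 FC″ at a non-closed bad point whose spread residual is finite and absorbing -/

/-- **FC″ AT A FINITE ABSORBING-RESIDUAL POINT ⟸ (T3ᵃ)** (the def `RelClosedFixR.FCUnguardedOfFiniteResidualR`, p573608): iterate the
absorbing step from the spread `J₀` until the residual is empty; `η ∈ supp J` because `η` is non-FULL; (nc)/(cl) over `supp J ⊆ V′` from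
`GoodOver J V′`; the `η`-datum is RE-DERIVED by `locFixData_of_goodOver_nhd` for a finite generating tuple of `J_η` (Noetherian stalk) — the
pinned datum `c′` is not propagated. [folklore assembly, OURS] -/
theorem fcUnguardedOfFiniteResidualR_of_absorbingStep (h : AbsorbingClosedPointStep) : RelClosedFixR.FCUnguardedOfFiniteResidualR := by
  intro p hp k _ _ X₁ f₁ hs hft hqc hi h4 hCM η hη hres
  obtain ⟨hηcl, hbad, -⟩ := hη
  obtain ⟨n', c', J₀, V, Z, hdat, hstalk, hZcl, hZfin, hηZ, hZsub, hJV, hgood⟩ := hres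
  haveI := hft
  haveI := hi
  haveI : IsLocallyNoetherian X₁ := LocallyOfFiniteType.isLocallyNoetherian f₁
  -- `J₀ ≠ ⊥` and `η ∈ supp J₀`
  have hJ₀ : J₀ ≠ ⊥ := by
    intro h0
    apply hdat.1
    rw [← hstalk, h0]
    exact stalkIdeal_bot η
  have hηJ₀ : η ∈ (J₀.support : Set X₁) := (mem_support_iff_stalkIdeal_le J₀ η).mpr (by rw [hstalk]; exact hdat.2.1)
  -- `η` is not FULL
  have hηbad : ¬ FullCl p (X₁.presheaf.stalk η) := fun hF => hbad fun d hd s hs => (hF.2 d hd s hs).2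
  -- iterate the step
  obtain ⟨J, V', hJ, hJV', hgoodJ, hkeep⟩ := absorbingStep_iterate (p := p)
    (fun J₀' Z' V₀ b hJ₀' hZ' hf hZ's hJ₀'V hg hb => h p hp k X₁ f₁ hs hft hqc hi h4 hCM J₀' Z' V₀ b hJ₀' hZ' hf hZ's hJ₀'V hg hb)
    _ J₀ Z V hJ₀ hZcl hZfin le_rfl hZsub hJV hgood
  have hηJ : η ∈ (J.support : Set X₁) := hkeep η hηJ₀ hηbad
  -- a finite generating tuple of `J_η` and its (A′) datum
  obtain ⟨m, c, hc⟩ := Submodule.fg_iff_exists_fin_generating_family.mp (IsNoetherian.noetherian (stalkIdeal J η))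
  have hc' : Ideal.span (Set.range c) = stalkIdeal J η := hc
  have hdatJ : LocFixData p X₁ η m c := locFixData_of_goodOver_nhd p (hJV' hηJ) hηcl hJ hηJ hgoodJ c hc'
  obtain ⟨hne, hle, hcharts⟩ := hdatJ
  refine ⟨J, m, c, hJ, hηJ, hne, hle, hcharts, hc'.symm, fun X₂ π hπ => ?_⟩
  obtain ⟨hnc, hcl⟩ := RelClosedSubsetFixFinite.goodOver_mono hJV' hgoodJ X₂ π hπ
  exact ⟨fun x hx _ hxcl => hnc x hx hxcl, fun x hx hxcl => hcl x hx hxcl⟩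

/-! ## §5 The token-fixed step (plan-1 R16.38/R16.42: keep-clause for NON-CLOSED points only) and the pinned rung as an instance -/

/-- [OURS · CANDIDATE statement, not a fact] **(T3ᵃ′) `AbsorbingClosedPointStepNC`** = `AbsorbingClosedPointStep` with the keep-clause restricted
to NON-CLOSED points: `… → ¬ IsClosed {x} → ¬ FullCl p 𝒪_x → x ∈ supp J₁` (plan-1 R16.38 TOKEN FIX, R16.42 (1); tri-2 PASS 21:35:35Z). A
WEAKENING of (T3ᵃ) (`absorbingStepNC_of_step`); it is what the iteration and the finite-residual corollary consume, and the pinned rung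
`RelClosedFixR.RelClosedFixR` certifies it (`absorbingStepNC_of_relClosedFixR`). [candidate statement, OURS; open] -/
@[conjecture] def AbsorbingClosedPointStepNC : Prop :=
  ∀ (p : ℕ), p.Prime → ∀ (k : Type) [Field k] [CharP k p]
    (X₁ : Scheme.{0}) (f₁ : X₁ ⟶ Spec (.of k)),
      IsSeparated f₁ → LocallyOfFiniteType f₁ → QuasiCompact f₁ → IsIntegral X₁ → 4 ≤ topologicalKrullDim X₁ →
      (∀ x : X₁, CMCl (X₁.presheaf.stalk x)) →
      ∀ (J₀ : X₁.IdealSheafData) (Z : Set X₁) (V : X₁.Opens) (b : X₁), J₀ ≠ ⊥ → IsClosed Z → Z.Finite →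
        Z ⊆ (J₀.support : Set X₁) → (J₀.support : Set X₁) ⊆ (V : Set X₁) → GoodOver p X₁ J₀ ((V : Set X₁) \ Z) → b ∈ Z →
        ∃ (J₁ : X₁.IdealSheafData) (V₁ : X₁.Opens) (Z₁ : Set X₁), J₁ ≠ ⊥ ∧ IsClosed Z₁ ∧ Z₁ ⊆ Z \ {b} ∧
          Z₁ ⊆ (J₁.support : Set X₁) ∧ (J₁.support : Set X₁) ⊆ (V₁ : Set X₁) ∧ GoodOver p X₁ J₁ ((V₁ : Set X₁) \ Z₁) ∧
          (∀ x : X₁, x ∈ (J₀.support : Set X₁) → ¬ IsClosed ({x} : Set X₁) → ¬ FullCl p (X₁.presheaf.stalk x) → x ∈ (J₁.support : Set X₁))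

/-- (T3ᵃ) ⇒ (T3ᵃ′) (drop the closed points from the keep-clause). [plumbing] -/
theorem absorbingStepNC_of_step (h : AbsorbingClosedPointStep) : AbsorbingClosedPointStepNC := by
  intro p hp k _ _ X₁ f₁ hs hft hqc hi h4 hCM J₀ Z V b hJ₀ hZcl hZfin hZsub hJV hgood hb
  obtain ⟨J₁, V₁, Z₁, h1, h2, h3, h4', h5, h6, h7⟩ := h p hp k X₁ f₁ hs hft hqc hi h4 hCM J₀ Z V b hJ₀ hZcl hZfin hZsub hJV hgood hb
  exact ⟨J₁, V₁, Z₁, h1, h2, h3, h4', h5, h6, fun x hx _ hbad => h7 x hx hbad⟩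

/-- **ITERATION of (T3ᵃ′)** (same induction; the keep-clause is carried for non-closed points). [folklore assembly, OURS] -/
theorem absorbingStepNC_iterate {X₁ : Scheme.{0}} {p : ℕ}
    (hstep : ∀ (J₀ : X₁.IdealSheafData) (Z : Set X₁) (V : X₁.Opens) (b : X₁), J₀ ≠ ⊥ → IsClosed Z → Z.Finite →
      Z ⊆ (J₀.support : Set X₁) → (J₀.support : Set X₁) ⊆ (V : Set X₁) → GoodOver p X₁ J₀ ((V : Set X₁) \ Z) → b ∈ Z →
      ∃ (J₁ : X₁.IdealSheafData) (V₁ : X₁.Opens) (Z₁ : Set X₁), J₁ ≠ ⊥ ∧ IsClosed Z₁ ∧ Z₁ ⊆ Z \ {b} ∧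
        Z₁ ⊆ (J₁.support : Set X₁) ∧ (J₁.support : Set X₁) ⊆ (V₁ : Set X₁) ∧ GoodOver p X₁ J₁ ((V₁ : Set X₁) \ Z₁) ∧
        (∀ x : X₁, x ∈ (J₀.support : Set X₁) → ¬ IsClosed ({x} : Set X₁) → ¬ FullCl p (X₁.presheaf.stalk x) → x ∈ (J₁.support : Set X₁))) :
    ∀ (n : ℕ) (J₀ : X₁.IdealSheafData) (Z : Set X₁) (V : X₁.Opens), J₀ ≠ ⊥ → IsClosed Z → Z.Finite → Z.ncard ≤ n →
      Z ⊆ (J₀.support : Set X₁) → (J₀.support : Set X₁) ⊆ (V : Set X₁) → GoodOver p X₁ J₀ ((V : Set X₁) \ Z) →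
      ∃ (J : X₁.IdealSheafData) (V' : X₁.Opens), J ≠ ⊥ ∧ (J.support : Set X₁) ⊆ (V' : Set X₁) ∧ GoodOver p X₁ J (V' : Set X₁) ∧
        (∀ x : X₁, x ∈ (J₀.support : Set X₁) → ¬ IsClosed ({x} : Set X₁) → ¬ FullCl p (X₁.presheaf.stalk x) → x ∈ (J.support : Set X₁)) := by
  intro n
  induction n with
  | zero =>
    intro J₀ Z V hJ₀ _ hfin hcard _ hJV hgood
    have hempty : Z = ∅ := (Set.ncard_eq_zero hfin).mp (Nat.le_zero.mp hcard)
    refine ⟨J₀, V, hJ₀, hJV, ?_, fun x hx _ _ => hx⟩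
    rw [hempty, Set.sdiff_empty] at hgood
    exact hgood
  | succ n ih =>
    intro J₀ Z V hJ₀ hZcl hfin hcard hZsub hJV hgood
    rcases Z.eq_empty_or_nonempty with hZ | ⟨b, hb⟩
    · refine ⟨J₀, V, hJ₀, hJV, ?_, fun x hx _ _ => hx⟩
      rw [hZ, Set.sdiff_empty] at hgood
      exact hgood
    · obtain ⟨J₁, V₁, Z₁, hJ₁, hZ₁cl, hZ₁sub, hZ₁J, hJ₁V, hgood₁, hkeep⟩ := hstep J₀ Z V b hJ₀ hZcl hfin hZsub hJV hgood hb
      have hfin' : (Z \ {b}).Finite := hfin.subset Set.sdiff_subset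
      have hfin₁ : Z₁.Finite := hfin'.subset hZ₁sub
      have hcard₁ : Z₁.ncard ≤ n := by
        have h1 := Set.ncard_le_ncard hZ₁sub hfin'
        have h2 : (Z \ {b}).ncard = Z.ncard - 1 := Set.ncard_sdiff_singleton_of_mem hb
        omega
      obtain ⟨J, V', hJ, hJV', hgoodJ, hkeep'⟩ := ih J₁ Z₁ V₁ hJ₁ hZ₁cl hfin₁ hcard₁ hZ₁J hJ₁V hgood₁
      exact ⟨J, V', hJ, hJV', hgoodJ, fun x hx hxcl hbad => hkeep' x (hkeep x hx hxcl hbad) hxcl hbad⟩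

/-- **FC″ AT A FINITE ABSORBING-RESIDUAL POINT ⟸ (T3ᵃ′)** (the keep-clause is only used at the NON-closed `η`). [folklore assembly, OURS] -/
theorem fcUnguardedOfFiniteResidualR_of_absorbingStepNC (h : AbsorbingClosedPointStepNC) : RelClosedFixR.FCUnguardedOfFiniteResidualR := by
  intro p hp k _ _ X₁ f₁ hs hft hqc hi h4 hCM η hη hres
  obtain ⟨hηcl, hbad, -⟩ := hη
  obtain ⟨n', c', J₀, V, Z, hdat, hstalk, hZcl, hZfin, hηZ, hZsub, hJV, hgood⟩ := hres
  haveI := hft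
  haveI := hi
  haveI : IsLocallyNoetherian X₁ := LocallyOfFiniteType.isLocallyNoetherian f₁
  have hJ₀ : J₀ ≠ ⊥ := by
    intro h0
    apply hdat.1
    rw [← hstalk, h0]
    exact stalkIdeal_bot η
  have hηJ₀ : η ∈ (J₀.support : Set X₁) := (mem_support_iff_stalkIdeal_le J₀ η).mpr (by rw [hstalk]; exact hdat.2.1)
  have hηbad : ¬ FullCl p (X₁.presheaf.stalk η) := fun hF => hbad fun d hd s hs => (hF.2 d hd s hs).2
  obtain ⟨J, V', hJ, hJV', hgoodJ, hkeep⟩ := absorbingStepNC_iterate (p := p)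
    (fun J₀' Z' V₀ b hJ₀' hZ' hf hZ's hJ₀'V hg hb => h p hp k X₁ f₁ hs hft hqc hi h4 hCM J₀' Z' V₀ b hJ₀' hZ' hf hZ's hJ₀'V hg hb)
    _ J₀ Z V hJ₀ hZcl hZfin le_rfl hZsub hJV hgood
  have hηJ : η ∈ (J.support : Set X₁) := hkeep η hηJ₀ hηcl hηbad
  obtain ⟨m, c, hc⟩ := Submodule.fg_iff_exists_fin_generating_family.mp (IsNoetherian.noetherian (stalkIdeal J η))
  have hc' : Ideal.span (Set.range c) = stalkIdeal J η := hc
  obtain ⟨hne, hle, hcharts⟩ := locFixData_of_goodOver_nhd p (hJV' hηJ) hηcl hJ hηJ hgoodJ c hc'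
  refine ⟨J, m, c, hJ, hηJ, hne, hle, hcharts, hc'.symm, fun X₂ π hπ => ?_⟩
  obtain ⟨hnc, hcl⟩ := RelClosedSubsetFixFinite.goodOver_mono hJV' hgoodJ X₂ π hπ
  exact ⟨fun x hx _ hxcl => hnc x hx hxcl, fun x hx hxcl => hcl x hx hxcl⟩

/-- **The PINNED rung certifies the absorbing step** (plan-1 R16.36 (2)(f)): a (T3ʳ)-cure `J₁ ≡ J₀ⁿ` off `b`, good over `W′ ∋ b`, is an
absorbing datum `(J₁, V, Z ∖ {b})` — goodness over `V ∖ Z` transports along the power agreement off `b` (`goodOver_of_stalkIdeal_eq_pow_off_closed`,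
p569490), over `b` it is given; non-closed points `≠ b` keep their (powered) stalks. So every pinned local specimen certifies an instance of
(T3ᵃ′). [folklore assembly, OURS] -/
theorem absorbingStepNC_of_relClosedFixR (h : RelClosedFixR.RelClosedFixR) : AbsorbingClosedPointStepNC := by
  intro p hp k _ _ X₁ f₁ hs hft hqc hi h4 hCM J₀ Z V b hJ₀ hZcl hZfin hZsub hJV hgood hb
  haveI := hft
  haveI := hi
  haveI : IsLocallyNoetherian X₁ := LocallyOfFiniteType.isLocallyNoetherian f₁
  haveI : JacobsonSpace X₁ := LocallyOfFiniteType.jacobsonSpace f₁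
  have hbcl : IsClosed ({b} : Set X₁) := RelClosedSubsetFixFinite.isClosed_singleton_of_mem_finite_isClosed hZcl hZfin hb
  -- the punctured open `W := V ∖ (Z ∖ {b}) ∋ b`, with `W ∖ {b} ⊆ V ∖ Z`
  have hZbcl : IsClosed (Z \ {b}) := by
    rw [← Set.biUnion_of_singleton (Z \ {b})]
    exact (hZfin.subset Set.sdiff_subset).isClosed_biUnion fun x hx =>
      RelClosedSubsetFixFinite.isClosed_singleton_of_mem_finite_isClosed hZcl hZfin hx.1
  let W : X₁.Opens := ⟨(V : Set X₁) \ (Z \ {b}), V.isOpen.sdiff hZbcl⟩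
  have hbW : b ∈ (W : Set X₁) := ⟨hJV (hZsub hb), fun hh => hh.2 rfl⟩
  have hWsub : (W : Set X₁) \ {b} ⊆ (V : Set X₁) \ Z := fun x hx => ⟨hx.1.1, fun hz => hx.1.2 ⟨hz, hx.2⟩⟩
  obtain ⟨J₁, n, W', hn, hbW', hagree, hgood₁⟩ :=
    h p hp k X₁ f₁ hs hft hqc hi h4 hCM J₀ b W hbcl (hZsub hb) hbW (RelClosedSubsetFixFinite.goodOver_mono hWsub hgood)
  obtain ⟨m, rfl⟩ : ∃ m, n = m + 1 := ⟨n - 1, (Nat.sub_add_cancel hn).symm⟩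
  -- stalks off `b`: proper iff proper
  have hsupp : ∀ x : X₁, x ≠ b → (x ∈ (J₁.support : Set X₁) ↔ x ∈ (J₀.support : Set X₁)) := by
    intro x hxb
    rw [show x ∈ (J₁.support : Set X₁) ↔ x ∈ J₁.support from Iff.rfl, show x ∈ (J₀.support : Set X₁) ↔ x ∈ J₀.support from Iff.rfl,
      mem_support_iff_stalkIdeal_le, mem_support_iff_stalkIdeal_le, hagree x hxb]
    constructor
    · intro hle
      refine le_maximalIdeal fun htop => ?_
      rw [htop, Ideal.top_pow] at hle
      exact (maximalIdeal.isMaximal _).ne_top (top_le_iff.mp hle)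
    · intro hle
      exact RelClosedFixR.pow_le_maximalIdeal_of_le hle (Nat.succ_pos m)
  refine ⟨J₁, V, Z \ {b}, ?_, hZbcl, subset_rfl, ?_, ?_, ?_, ?_⟩
  · -- `J₁ ≠ ⊥`: its stalk at the generic point is a power of the (nonzero) stalk of `J₀`
    intro h0
    have hξb : genericPoint X₁ ≠ b := by
      intro hξ
      -- then every point specialises from the CLOSED point `b`, so `X₁ = {b}` is discrete of dimension `0 < 4`
      have hall : ∀ y : X₁, y = b := fun y =>
        Set.mem_singleton_iff.mp (((genericPoint_specializes y).mem_closed hbcl) (by rw [hξ]; rfl))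
      haveI : Subsingleton X₁ := ⟨fun x y => by rw [hall x, hall y]⟩
      have hdim : topologicalKrullDim X₁ ≤ 0 := topologicalKrullDim_zero_of_discreteTopology X₁
      have h4' : (4 : WithBot ℕ∞) ≤ 0 := h4.trans hdim
      exact absurd h4' (by decide)
    have hst := hagree (genericPoint X₁) hξb
    rw [h0, stalkIdeal_bot] at hst
    exact stalkIdeal_ne_bot_of_ne_bot hJ₀ (genericPoint X₁) (pow_eq_zero_iff (Nat.succ_ne_zero m) |>.mp hst.symm)
  · intro x hx
    exact (hsupp x hx.2).mpr (hZsub hx.1)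
  · intro x hx
    by_cases hxb : x = b
    · exact hxb ▸ hJV (hZsub hb)
    · exact hJV ((hsupp x hxb).mp hx)
  · -- goodness over `V ∖ (Z ∖ {b}) ⊆ (V ∖ Z) ∪ W′`
    have ht := RelClosedSubsetFixFinite.goodOver_of_stalkIdeal_eq_pow_off_closed (p := p) hbcl m hagree hgood
    refine RelClosedSubsetFixFinite.goodOver_mono ?_ (RelClosedFixR.goodOver_union ht hgood₁)
    intro x hx
    by_cases hxb : x = b
    · exact Or.inr (hxb ▸ hbW')
    · exact Or.inl ⟨⟨hx.1, fun hz => hx.2 ⟨hz, hxb⟩⟩, hxb⟩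
  · intro x hx hxcl _
    have hxb : x ≠ b := fun hxb => hxcl (hxb ▸ hbcl)
    exact (hsupp x hxb).mpr hx

end Summit.ResolutionOfSingularities.ResolutionOfSingularities.Theorems.FInjectiveMacaulayfication.AbsorbingStep

end
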